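import Summits.ValiantsHypothesis.ValiantsHypothesis.Theorems.LacunarySymmetroidMatrixDescartesIndexOnePsdAtRoots

/-!
# `MatrixDescartes` (stmt-ValiantsHypothesis-18050) — pivot column at index one: THE TWISTED WRONSKIAN IS A QUADRATIC FORM
# `W_e(wᵀadj(𝔻)w, det 𝔻) = yᵀ 𝔼_e y`, `y = adj(𝔻) w`, `𝔼_e = ∑ₖ (e − dₖ) X^{dₖ} Pₖ` — so one-sided pencils have a one-signed Wronskian

HONEST FRAMING.  Cell `pub-symmetroid`, seat `val-sym-mdr-p2` (gen 23); helper file `--supports` the crux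
`Theses.LacunarySymmetroid.MatrixDescartes` (OPEN), NO closure claim.  Structure theorem for conjb-1's index-one pivot column
(`…CensusPivotDefs`) continuing `…CensusSecularRolle` (conjb-1 g2: `Z₊(D − X^e N) ≤ 1 + Z₊(W_e(N,D))`) and this seat's
`…IndexOneInflection` (p677643: `det F = det 𝔻 − X^e·wᵀadj(𝔻)w`, inflection bound) and `…IndexOnePsdAtRoots` (p678011).  Nothing here bears on `MatrixDescartes` in its
window, on `stub_twoSided`, on `DoorA26` / `DoorA34`, the census registers, or `VP ≠ VNP`.

CONTENT.  For the PSD skeleton `𝔻 = X^e A + ∑ₖ X^{dₖ} Pₖ` (symmetric letters) and `w : Fin m → ℝ` put `y := adj(𝔻) w ∈ ℝ[X]^m`,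
`N := wᵀ y = wᵀ adj(𝔻) w`, `D̃ := det 𝔻`.  Polynomial identities (no invertibility anywhere):
* `skeleton_mulVec_adj`: `𝔻 y = D̃·w`;  `form_skeleton`: `yᵀ 𝔻 y = D̃·N`;
* `mulVec_derivative` (product rule for `M *ᵥ v` over `ℝ[X]`), `form_skeleton_derivative`: `yᵀ 𝔻′ y = D̃′ N − D̃ N′`;
* **`twistedWronskian_eq_form`**: `W_e(N, D̃) = e·N D̃ + X(N′D̃ − N D̃′) = yᵀ 𝔼_e y`, `𝔼_e := ∑ₖ (e − dₖ)·X^{dₖ}·Pₖ` — the pivot's own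
  PSD letter `A` drops out (weight `e − e = 0`), the level never entered: the twisted Wronskian of the secular Rolle step is the
  EXPONENT-WEIGHTED PENCIL evaluated on the adjugate vector.  At a positive root `x₀` of `det F` the real vector `y(x₀)` is a kernel vector
  of `F(x₀)` and `W_e(x₀) = −x₀·(Rayleigh slope)`: the sign of `W_e` at a node is its ascending/descending TYPE (chain method).
* `twistedWronskian_skeleton_eval`: `W_e(x) = ∑ₖ (e − dₖ) x^{dₖ} · y(x)ᵀ Pₖ y(x)` with `y(x) = adj(𝔻(x)) w`;
* **`twistedWronskian_nonpos_of_le` / `…_nonneg_of_ge`**: `Pₖ ⪰ 0` and all `dₖ ≥ e` (resp. `≤ e`) ⇒ `W_e ≤ 0` (resp. `≥ 0`) on `(0, ∞)`: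
  ONE-SIDED index-one pencils have a one-signed twisted Wronskian (the dent calculus' form of R0 `OneSidedIndexRung`; the two-sided
  count is the sign competition between the letters below and above the pivot inside ONE quadratic form).

[folklore] Adjugate identities `𝔻·adj 𝔻 = det 𝔻 · 1` (Mathlib `Matrix.mul_adjugate`), the product rule over `ℝ[X]`.
Axioms `propext`, `Classical.choice`, `Quot.sound`.
-/

set_option linter.dupNamespace false

namespace Summit.ValiantsHypothesis.ValiantsHypothesis.Theorems.LacunarySymmetroidMatrixDescartes.SecularRolle

open Polynomial Matrix Finset
open scoped BigOperators

variable {m K : ℕ}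

/-- The PSD skeleton `𝔻 = X^e A + ∑ X^{dₖ} Pₖ` (local notation, as in `…IndexOneInflection`). -/
local notation3 (prettyPrint := false) "𝔻[" e ", " d ", " A ", " P "]" =>
  ((X : ℝ[X]) ^ (e : ℕ)) • (A : Matrix (Fin _) (Fin _) ℝ).map Polynomial.C
    + ∑ k, ((X : ℝ[X]) ^ (d : Fin _ → ℕ) k) • ((P : Fin _ → Matrix (Fin _) (Fin _) ℝ) k).map Polynomial.C

/-- The constant vector `w` in `ℝ[X]^m` (local notation). -/
local notation3 (prettyPrint := false) "𝕔[" w "]" => (fun i => Polynomial.C ((w : Fin _ → ℝ) i))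

/-- The exponent-weighted pencil `𝔼_e = ∑ₖ (e − dₖ)·X^{dₖ}·Pₖ` (local notation). -/
local notation3 (prettyPrint := false) "𝔼[" e ", " d ", " P "]" =>
  ∑ k, Polynomial.C (((e : ℕ) : ℝ) - ((d : Fin _ → ℕ) k : ℝ))
    • (((X : ℝ[X]) ^ (d : Fin _ → ℕ) k) • ((P : Fin _ → Matrix (Fin _) (Fin _) ℝ) k).map Polynomial.C)

/-! ### §1. Adjugate identities for the skeleton -/

/-- `𝔻 · (adj 𝔻 · w) = det 𝔻 · w`. [folklore] -/
theorem skeleton_mulVec_adj (e : ℕ) (d : Fin K → ℕ) (A : Matrix (Fin m) (Fin m) ℝ) (w : Fin m → ℝ)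
    (P : Fin K → Matrix (Fin m) (Fin m) ℝ) :
    (𝔻[e, d, A, P]) *ᵥ ((𝔻[e, d, A, P]).adjugate *ᵥ 𝕔[w]) = Matrix.det (𝔻[e, d, A, P]) • 𝕔[w] := by
  rw [Matrix.mulVec_mulVec, Matrix.mul_adjugate, Matrix.smul_mulVec, Matrix.one_mulVec]

/-- The skeleton is a symmetric matrix over `ℝ[X]` when its letters are symmetric. [folklore] -/
theorem skeleton_transpose (e : ℕ) (d : Fin K → ℕ) {A : Matrix (Fin m) (Fin m) ℝ}
    {P : Fin K → Matrix (Fin m) (Fin m) ℝ} (hA : A.IsSymm) (hP : ∀ k, (P k).IsSymm) :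
    (𝔻[e, d, A, P])ᵀ = 𝔻[e, d, A, P] := by
  ext i j
  simp only [Matrix.transpose_apply, Matrix.add_apply, Matrix.smul_apply, Matrix.map_apply, Matrix.sum_apply,
    hA.apply i j, fun k => (hP k).apply i j]

/-- `yᵀ 𝔻 y = det 𝔻 · N` with `y = adj(𝔻) w`, `N = wᵀ adj(𝔻) w`. [folklore] -/
theorem form_skeleton (e : ℕ) (d : Fin K → ℕ) (A : Matrix (Fin m) (Fin m) ℝ) (w : Fin m → ℝ)
    (P : Fin K → Matrix (Fin m) (Fin m) ℝ) :
    ((𝔻[e, d, A, P]).adjugate *ᵥ 𝕔[w]) ⬝ᵥ ((𝔻[e, d, A, P]) *ᵥ ((𝔻[e, d, A, P]).adjugate *ᵥ 𝕔[w]))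
      = Matrix.det (𝔻[e, d, A, P]) * (𝕔[w] ⬝ᵥ ((𝔻[e, d, A, P]).adjugate *ᵥ 𝕔[w])) := by
  rw [skeleton_mulVec_adj, dotProduct_smul, smul_eq_mul, dotProduct_comm]

/-! ### §2. The product rule over `ℝ[X]` and the derivative identity -/

/-- Product rule for `M *ᵥ v` over `ℝ[X]`, entrywise. [folklore] -/
theorem mulVec_derivative (M : Matrix (Fin m) (Fin m) ℝ[X]) (v : Fin m → ℝ[X]) :
    (fun i => derivative ((M *ᵥ v) i)) = M.map derivative *ᵥ v + M *ᵥ (fun i => derivative (v i)) := by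
  funext i
  simp only [Matrix.mulVec, dotProduct, Pi.add_apply, Matrix.map_apply, ← Finset.sum_add_distrib]
  rw [Polynomial.derivative_sum]
  exact Finset.sum_congr rfl fun j _ => by rw [derivative_mul]

/-- Derivative of `wᵀ v` for constant `w`. [folklore] -/
theorem derivative_dotProduct_const (w : Fin m → ℝ) (v : Fin m → ℝ[X]) :
    derivative (𝕔[w] ⬝ᵥ v) = 𝕔[w] ⬝ᵥ (fun i => derivative (v i)) := by
  simp only [dotProduct]
  rw [Polynomial.derivative_sum]
  exact Finset.sum_congr rfl fun j _ => by rw [derivative_mul, derivative_C, zero_mul, zero_add]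

/-- **`yᵀ 𝔻′ y = D̃′ N − D̃ N′`** (`y = adj(𝔻)w`, `N = wᵀ y`, `D̃ = det 𝔻`; symmetric letters): differentiate `𝔻 y = D̃ w` and pair
with `y`. [folklore] -/
theorem form_skeleton_derivative (e : ℕ) (d : Fin K → ℕ) {A : Matrix (Fin m) (Fin m) ℝ} (w : Fin m → ℝ)
    {P : Fin K → Matrix (Fin m) (Fin m) ℝ} (hA : A.IsSymm) (hP : ∀ k, (P k).IsSymm) :
    ((𝔻[e, d, A, P]).adjugate *ᵥ 𝕔[w]) ⬝ᵥ ((𝔻[e, d, A, P]).map derivative *ᵥ ((𝔻[e, d, A, P]).adjugate *ᵥ 𝕔[w]))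
      = derivative (Matrix.det (𝔻[e, d, A, P])) * (𝕔[w] ⬝ᵥ ((𝔻[e, d, A, P]).adjugate *ᵥ 𝕔[w]))
        - Matrix.det (𝔻[e, d, A, P]) * derivative (𝕔[w] ⬝ᵥ ((𝔻[e, d, A, P]).adjugate *ᵥ 𝕔[w])) := by
  set D := (𝔻[e, d, A, P]) with hDdef
  set y := D.adjugate *ᵥ 𝕔[w] with hy
  -- product rule on `D y = det D · w`
  have h1 : (fun i => derivative ((D *ᵥ y) i)) = D.map derivative *ᵥ y + D *ᵥ (fun i => derivative (y i)) :=
    mulVec_derivative D y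
  have h2 : (fun i => derivative ((D *ᵥ y) i)) = derivative D.det • 𝕔[w] := by
    ext i
    have := congrFun (skeleton_mulVec_adj e d A w P) i
    rw [← hDdef, ← hy] at this
    rw [this]
    simp [derivative_mul]
  have h3 : D.map derivative *ᵥ y = derivative D.det • 𝕔[w] - D *ᵥ (fun i => derivative (y i)) := by
    rw [← h2, h1]; abel
  -- pair with `y`; symmetry of `D` moves `D` across
  have hT : Dᵀ = D := skeleton_transpose e d hA hP
  have h4 : y ⬝ᵥ (D *ᵥ fun i => derivative (y i)) = D.det * derivative (𝕔[w] ⬝ᵥ y) := by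
    rw [Matrix.dotProduct_mulVec, ← Matrix.mulVec_transpose, hT, hy, skeleton_mulVec_adj, ← hy,
      smul_dotProduct, smul_eq_mul, derivative_dotProduct_const]
  rw [h3, dotProduct_sub, dotProduct_smul, smul_eq_mul, h4, dotProduct_comm]

/-! ### §3. `X·𝔻′` is the exponent-weighted skeleton, and the form identity -/

/-- `X · (Xⁿ)′ = n · Xⁿ`. [folklore] -/
theorem X_mul_derivative_X_pow (n : ℕ) : (X : ℝ[X]) * derivative ((X : ℝ[X]) ^ n) = Polynomial.C (n : ℝ) * X ^ n := by
  rcases n with _ | n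
  · simp
  · rw [derivative_X_pow, Nat.succ_sub_one, pow_succ]
    simp only [Nat.cast_succ, map_add, map_natCast, map_one]
    ring

/-- `X · 𝔻′ = e·X^e A + ∑ dₖ X^{dₖ} Pₖ` (entrywise Euler operator). [folklore] -/
theorem X_smul_skeleton_derivative (e : ℕ) (d : Fin K → ℕ) (A : Matrix (Fin m) (Fin m) ℝ)
    (P : Fin K → Matrix (Fin m) (Fin m) ℝ) :
    (X : ℝ[X]) • (𝔻[e, d, A, P]).map derivative
      = Polynomial.C (e : ℝ) • (((X : ℝ[X]) ^ e) • A.map Polynomial.C)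
        + ∑ k, Polynomial.C ((d k : ℕ) : ℝ) • (((X : ℝ[X]) ^ d k) • (P k).map Polynomial.C) := by
  refine Matrix.ext fun i j => ?_
  simp only [Matrix.smul_apply, Matrix.map_apply, Matrix.add_apply, Matrix.sum_apply, smul_eq_mul, derivative_add,
    derivative_mul, derivative_C, mul_zero, add_zero, mul_add]
  have h1 : (X : ℝ[X]) * (derivative ((X : ℝ[X]) ^ e) * Polynomial.C (A i j))
      = Polynomial.C (e : ℝ) * ((X : ℝ[X]) ^ e * Polynomial.C (A i j)) := by
    rw [← mul_assoc, X_mul_derivative_X_pow, mul_assoc]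
  have h2 : ∀ k : Fin K, (X : ℝ[X]) * derivative ((X : ℝ[X]) ^ d k * Polynomial.C (P k i j))
      = Polynomial.C ((d k : ℕ) : ℝ) * ((X : ℝ[X]) ^ d k * Polynomial.C (P k i j)) := fun k => by
    rw [derivative_mul, derivative_C, mul_zero, add_zero, ← mul_assoc, X_mul_derivative_X_pow, mul_assoc]
  rw [h1, Polynomial.derivative_sum, Finset.mul_sum]
  simp only [h2]

/-- **THE TWISTED WRONSKIAN IS A QUADRATIC FORM.**  With `y = adj(𝔻) w`, `N = wᵀ adj(𝔻) w`, `D̃ = det 𝔻` (symmetric letters):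
`W_e(N, D̃) = yᵀ 𝔼_e y`, `𝔼_e = ∑ₖ (e − dₖ)·X^{dₖ}·Pₖ` — the pivot's PSD letter `A` (weight `e − e = 0`) and the level are absent.
[folklore] -/
theorem twistedWronskian_eq_form (e : ℕ) (d : Fin K → ℕ) {A : Matrix (Fin m) (Fin m) ℝ} (w : Fin m → ℝ)
    {P : Fin K → Matrix (Fin m) (Fin m) ℝ} (hA : A.IsSymm) (hP : ∀ k, (P k).IsSymm) :
    twistedWronskian e (𝕔[w] ⬝ᵥ ((𝔻[e, d, A, P]).adjugate *ᵥ 𝕔[w])) (Matrix.det (𝔻[e, d, A, P]))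
      = ((𝔻[e, d, A, P]).adjugate *ᵥ 𝕔[w]) ⬝ᵥ ((𝔼[e, d, P]) *ᵥ ((𝔻[e, d, A, P]).adjugate *ᵥ 𝕔[w])) := by
  set D := (𝔻[e, d, A, P]) with hDdef
  set y := D.adjugate *ᵥ 𝕔[w] with hy
  set N := 𝕔[w] ⬝ᵥ y with hN
  have hform : y ⬝ᵥ (D *ᵥ y) = D.det * N := by rw [hy, hDdef]; exact form_skeleton e d A w P
  have hder : y ⬝ᵥ (D.map derivative *ᵥ y) = derivative D.det * N - D.det * derivative N := by
    rw [hy, hN, hDdef]; exact form_skeleton_derivative e d w hA hP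
  -- `X·(N′D̃ − N D̃′) = −yᵀ (X·𝔻′) y`
  have hX : X * (derivative N * D.det - N * derivative D.det) = -(y ⬝ᵥ (((X : ℝ[X]) • D.map derivative) *ᵥ y)) := by
    rw [Matrix.smul_mulVec, dotProduct_smul, smul_eq_mul, hder]; ring
  have hE : (𝔼[e, d, P]) = Polynomial.C (e : ℝ) • D - (X : ℝ[X]) • D.map derivative := by
    rw [hDdef, X_smul_skeleton_derivative, smul_add, Finset.smul_sum]
    have : ∀ k : Fin K, Polynomial.C ((e : ℝ) - (d k : ℝ)) • (((X : ℝ[X]) ^ d k) • (P k).map Polynomial.C)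
        = Polynomial.C (e : ℝ) • (((X : ℝ[X]) ^ d k) • (P k).map Polynomial.C)
          - Polynomial.C ((d k : ℕ) : ℝ) • (((X : ℝ[X]) ^ d k) • (P k).map Polynomial.C) := fun k => by
      rw [map_sub, sub_smul]
    simp only [this, Finset.sum_sub_distrib]
    abel
  unfold twistedWronskian
  rw [hE, Matrix.sub_mulVec, dotProduct_sub, Matrix.smul_mulVec, dotProduct_smul, smul_eq_mul, hform, hX]
  ring

/-! ### §4. Evaluation and the one-sided sign -/

/-- Evaluating `y = adj(𝔻) w` at a real point: `y(x) = adj(𝔻(x)) w`. [folklore] -/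
theorem adj_mulVec_eval (e : ℕ) (d : Fin K → ℕ) (A : Matrix (Fin m) (Fin m) ℝ) (w : Fin m → ℝ)
    (P : Fin K → Matrix (Fin m) (Fin m) ℝ) (x : ℝ) (i : Fin m) :
    (((𝔻[e, d, A, P]).adjugate *ᵥ 𝕔[w]) i).eval x
      = ((x ^ e • A + ∑ k, x ^ d k • P k).adjugate *ᵥ w) i := by
  have hadj : ∀ i j, (((𝔻[e, d, A, P]).adjugate i j)).eval x = (x ^ e • A + ∑ k, x ^ d k • P k).adjugate i j := by
    intro i j
    have h := RingHom.map_adjugate (Polynomial.evalRingHom x) (𝔻[e, d, A, P])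
    rw [RingHom.mapMatrix_apply, RingHom.mapMatrix_apply, Polynomial.coe_evalRingHom, skeleton_map_eval] at h
    have hij := congrFun (congrFun h i) j
    rw [Matrix.map_apply] at hij
    exact hij
  simp only [Matrix.mulVec, dotProduct, Polynomial.eval_finsetSum, Polynomial.eval_mul, Polynomial.eval_C, hadj]

/-- Evaluation of a form `uᵀ M v` over `ℝ[X]` at a point. [folklore] -/
theorem eval_dotProduct_mulVec (x : ℝ) (u v : Fin m → ℝ[X]) (M : Matrix (Fin m) (Fin m) ℝ[X]) :
    (u ⬝ᵥ (M *ᵥ v)).eval x = (fun i => (u i).eval x) ⬝ᵥ ((M.map (Polynomial.eval x)) *ᵥ (fun i => (v i).eval x)) := by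
  simp only [dotProduct, Matrix.mulVec, Matrix.map_apply, Polynomial.eval_finsetSum, Polynomial.eval_mul]

/-- **`W_e(x) = ∑ₖ (e − dₖ) x^{dₖ} · y(x)ᵀ Pₖ y(x)`**, `y(x) = adj(𝔻(x)) w`, for every real `x` (symmetric letters). [folklore] -/
theorem twistedWronskian_skeleton_eval (e : ℕ) (d : Fin K → ℕ) {A : Matrix (Fin m) (Fin m) ℝ} (w : Fin m → ℝ)
    {P : Fin K → Matrix (Fin m) (Fin m) ℝ} (hA : A.IsSymm) (hP : ∀ k, (P k).IsSymm) (x : ℝ) :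
    (twistedWronskian e (𝕔[w] ⬝ᵥ ((𝔻[e, d, A, P]).adjugate *ᵥ 𝕔[w])) (Matrix.det (𝔻[e, d, A, P]))).eval x
      = ∑ k, ((e : ℝ) - (d k : ℝ)) * x ^ d k
          * (((x ^ e • A + ∑ l, x ^ d l • P l).adjugate *ᵥ w) ⬝ᵥ
              (P k *ᵥ ((x ^ e • A + ∑ l, x ^ d l • P l).adjugate *ᵥ w))) := by
  rw [twistedWronskian_eq_form e d w hA hP, eval_dotProduct_mulVec]
  have hy : (fun i => (((𝔻[e, d, A, P]).adjugate *ᵥ 𝕔[w]) i).eval x)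
      = (x ^ e • A + ∑ l, x ^ d l • P l).adjugate *ᵥ w := funext fun i => adj_mulVec_eval e d A w P x i
  have hE : (𝔼[e, d, P]).map (Polynomial.eval x) = ∑ k, (((e : ℝ) - (d k : ℝ)) * x ^ d k) • P k := by
    refine Matrix.ext fun i j => ?_
    simp only [Matrix.map_apply, Matrix.sum_apply, Matrix.smul_apply, smul_eq_mul, Polynomial.eval_finsetSum,
      Polynomial.eval_mul, Polynomial.eval_C, Polynomial.eval_pow, Polynomial.eval_X, mul_assoc]
  rw [hy, hE]
  simp only [Matrix.sum_mulVec, dotProduct_sum, Matrix.smul_mulVec, dotProduct_smul, smul_eq_mul]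

/-- A real symmetric PSD matrix is `IsSymm`. [folklore] -/
theorem isSymm_of_posSemidef {M : Matrix (Fin m) (Fin m) ℝ} (hM : M.PosSemidef) : M.IsSymm := by
  have h := hM.1
  unfold Matrix.IsHermitian at h
  unfold Matrix.IsSymm
  simpa using h

/-- **ONE-SIDED ⇒ ONE-SIGNED WRONSKIAN (above).**  `A` symmetric, `Pₖ ⪰ 0`, every `dₖ ≥ e` ⇒ `W_e(x) ≤ 0` for all `x > 0`
(with `A ⪰ 0`, `A + ∑Pₖ ≻ 0` this is the dent-calculus form of R0: the secular function `x^e wᵀ𝔻(x)⁻¹w` is non-increasing). [folklore] -/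
theorem twistedWronskian_nonpos_of_le (e : ℕ) (d : Fin K → ℕ) {A : Matrix (Fin m) (Fin m) ℝ} (w : Fin m → ℝ)
    {P : Fin K → Matrix (Fin m) (Fin m) ℝ} (hA : A.IsSymm) (hP : ∀ k, (P k).PosSemidef) (hd : ∀ k, e ≤ d k)
    {x : ℝ} (hx : 0 < x) :
    (twistedWronskian e (𝕔[w] ⬝ᵥ ((𝔻[e, d, A, P]).adjugate *ᵥ 𝕔[w])) (Matrix.det (𝔻[e, d, A, P]))).eval x ≤ 0 := by
  rw [twistedWronskian_skeleton_eval e d w hA (fun k => isSymm_of_posSemidef (hP k)) x]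
  refine Finset.sum_nonpos fun k _ => ?_
  have h1 : ((e : ℝ) - (d k : ℝ)) * x ^ d k ≤ 0 :=
    mul_nonpos_of_nonpos_of_nonneg (sub_nonpos.mpr (by exact_mod_cast hd k)) (pow_nonneg hx.le _)
  have h2 : 0 ≤ ((x ^ e • A + ∑ l, x ^ d l • P l).adjugate *ᵥ w) ⬝ᵥ
      (P k *ᵥ ((x ^ e • A + ∑ l, x ^ d l • P l).adjugate *ᵥ w)) := by
    simpa using (hP k).dotProduct_mulVec_nonneg ((x ^ e • A + ∑ l, x ^ d l • P l).adjugate *ᵥ w)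
  exact mul_nonpos_of_nonpos_of_nonneg h1 h2

/-- **ONE-SIDED ⇒ ONE-SIGNED WRONSKIAN (below).**  `A` symmetric, `Pₖ ⪰ 0`, every `dₖ ≤ e` ⇒ `W_e(x) ≥ 0` for all `x > 0`. [folklore] -/
theorem twistedWronskian_nonneg_of_ge (e : ℕ) (d : Fin K → ℕ) {A : Matrix (Fin m) (Fin m) ℝ} (w : Fin m → ℝ)
    {P : Fin K → Matrix (Fin m) (Fin m) ℝ} (hA : A.IsSymm) (hP : ∀ k, (P k).PosSemidef) (hd : ∀ k, d k ≤ e)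
    {x : ℝ} (hx : 0 < x) :
    0 ≤ (twistedWronskian e (𝕔[w] ⬝ᵥ ((𝔻[e, d, A, P]).adjugate *ᵥ 𝕔[w])) (Matrix.det (𝔻[e, d, A, P]))).eval x := by
  rw [twistedWronskian_skeleton_eval e d w hA (fun k => isSymm_of_posSemidef (hP k)) x]
  refine Finset.sum_nonneg fun k _ => ?_
  have h1 : 0 ≤ ((e : ℝ) - (d k : ℝ)) * x ^ d k :=
    mul_nonneg (sub_nonneg.mpr (by exact_mod_cast hd k)) (pow_nonneg hx.le _)
  have h2 : 0 ≤ ((x ^ e • A + ∑ l, x ^ d l • P l).adjugate *ᵥ w) ⬝ᵥ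
      (P k *ᵥ ((x ^ e • A + ∑ l, x ^ d l • P l).adjugate *ᵥ w)) := by
    simpa using (hP k).dotProduct_mulVec_nonneg ((x ^ e • A + ∑ l, x ^ d l • P l).adjugate *ᵥ w)
  exact mul_nonneg h1 h2

/-! ### §5. The adjugate vector at a root is the kernel vector -/

/-- **`F(x) · y(x) = det F(x) · w`** for the real matrices: `F(x) = x^e (A − w wᵀ) + ∑ x^{dₖ} Pₖ`, `y(x) = adj(𝔻(x)) w`,
`𝔻(x) = x^e A + ∑ x^{dₖ} Pₖ`.  Hence at a root of `det F` the adjugate vector `y(x₀)` is a KERNEL VECTOR of `F(x₀)` — the node vector of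
the chain method — and `W_e(x₀) = ∑ₖ (e − dₖ) x₀^{dₖ} y(x₀)ᵀPₖy(x₀)` (`twistedWronskian_skeleton_eval`) is `−x₀·` its Rayleigh slope.
[folklore] -/
theorem pivot_mulVec_adj_eq (e : ℕ) (d : Fin K → ℕ) (A : Matrix (Fin m) (Fin m) ℝ) (w : Fin m → ℝ)
    (P : Fin K → Matrix (Fin m) (Fin m) ℝ) (x : ℝ) :
    (x ^ e • (A - vecMulVec w w) + ∑ k, x ^ d k • P k) *ᵥ ((x ^ e • A + ∑ k, x ^ d k • P k).adjugate *ᵥ w)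
      = ((x ^ e • A + ∑ k, x ^ d k • P k).det
          - x ^ e * (w ⬝ᵥ ((x ^ e • A + ∑ k, x ^ d k • P k).adjugate *ᵥ w))) • w := by
  set D := x ^ e • A + ∑ k, x ^ d k • P k with hD
  have hsplit : x ^ e • (A - vecMulVec w w) + ∑ k, x ^ d k • P k = D - x ^ e • vecMulVec w w := by
    rw [hD, smul_sub]; abel
  rw [hsplit, Matrix.sub_mulVec, Matrix.mulVec_mulVec, Matrix.mul_adjugate, Matrix.smul_mulVec, Matrix.one_mulVec,
    Matrix.smul_mulVec, vecMulVec_mulVec_eq, smul_smul, ← sub_smul]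

/-- The same determinant over `ℝ`: `det F(x) = det 𝔻(x) − x^e · wᵀ adj(𝔻(x)) w` (Cauchy's formula). [folklore] -/
theorem det_pivot_real_eq (e : ℕ) (d : Fin K → ℕ) (A : Matrix (Fin m) (Fin m) ℝ) (w : Fin m → ℝ)
    (P : Fin K → Matrix (Fin m) (Fin m) ℝ) (x : ℝ) :
    (x ^ e • (A - vecMulVec w w) + ∑ k, x ^ d k • P k).det
      = (x ^ e • A + ∑ k, x ^ d k • P k).det - x ^ e * (w ⬝ᵥ ((x ^ e • A + ∑ k, x ^ d k • P k).adjugate *ᵥ w)) := by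
  have hsplit : x ^ e • (A - vecMulVec w w) + ∑ k, x ^ d k • P k
      = (x ^ e • A + ∑ k, x ^ d k • P k) + vecMulVec (-(x ^ e • w)) w := by
    have : vecMulVec (-(x ^ e • w)) w = -(x ^ e • vecMulVec w w) := by
      ext i j; simp [vecMulVec_apply, mul_assoc]
    rw [this, smul_sub]; abel
  rw [hsplit, Literature.LinearAlgebra.Matrix.det_add_vecMulVec_adjugate, Matrix.mulVec_neg, Matrix.mulVec_smul,
    dotProduct_neg, dotProduct_smul, smul_eq_mul, sub_eq_add_neg]

/-- **AT A ROOT, `y(x₀) = adj(𝔻(x₀)) w` IS A KERNEL VECTOR OF `F(x₀)`.** [folklore] -/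
theorem pivot_mulVec_adj_eq_zero_of_root (e : ℕ) (d : Fin K → ℕ) (A : Matrix (Fin m) (Fin m) ℝ) (w : Fin m → ℝ)
    (P : Fin K → Matrix (Fin m) (Fin m) ℝ) {x : ℝ}
    (hroot : (x ^ e • (A - vecMulVec w w) + ∑ k, x ^ d k • P k).det = 0) :
    (x ^ e • (A - vecMulVec w w) + ∑ k, x ^ d k • P k) *ᵥ ((x ^ e • A + ∑ k, x ^ d k • P k).adjugate *ᵥ w) = 0 := by
  rw [pivot_mulVec_adj_eq, ← det_pivot_real_eq, hroot, zero_smul]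

end Summit.ValiantsHypothesis.ValiantsHypothesis.Theorems.LacunarySymmetroidMatrixDescartes.SecularRolle
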